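import Summits.Ventures.YMGap.Conjectures.ChiralClockComparisonProof
import HarnessLib

/-!
# Venture YMGap — Conjectures/ChiralClockComparisonOddN.lean: the chiral clock comparison for `ℤ_N` with `N` ODD (every graph, multigraph form)
# — the Messager–Miracle-Solé–Pfister duplication needs exactly that `2` is a unit of `ℤ_N`

HONEST FRAMING (venture `Summits/Ventures/YMGap`, cell `pub-ymgap`, track Y2 ROBUST-BALL, seat ds-4 g15).  Two definitions (`clockWeightN`, `clockCorrN`)
and theorems; finite sums only.  `Conjectures/ChiralClockComparisonProof.lean` proves the typed conjecture (C) for `ℤ₃`; the proof uses of the number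
`3` only that `2` is invertible modulo it.  This file records the general statement: for every ODD `N ≥ 1`, every finite vertex type `V`, every finite
family of pair terms `j ↦ (u_j, v_j, a_j ≥ 0, φ_j)` and all `b, t`, the two-point function
`⟨ψ_N(k_b − k_t)⟩_{a,φ}` of the weight `exp(∑_j a_j cos(2π·val(k_{u_j} − k_{v_j})/N + φ_j))` on `V → ℤ/N` (`ψ_N(m) = e^{2πi·val(m)/N}`) satisfies
`Re(e^{−iψ} ⟨ψ_N(k_b−k_t)⟩_{a,φ}) ≤ Re ⟨ψ_N(k_b−k_t)⟩_{a,0}` for every real `ψ` (`re_exp_mul_clockCorrN_le`), hence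
**`clockComparisonN : ‖⟨ψ_N(k_b−k_t)⟩_{a,φ}‖ ≤ Re ⟨ψ_N(k_b−k_t)⟩_{a,0}`** and Griffiths' first inequality `0 ≤ Re ⟨ψ_N(k_b−k_t)⟩_{a,0}`.  The substitution is
`k = p − q`, `k' = p + q` with inverse `p = h(k + k')`, `q = h(k' − k)`, `h = (N+1)/2` the inverse of `2`.  (For EVEN `N` the substitution is not a
bijection and the statement is not claimed; `N = 2` is GKS.)  The `ℤ₃` multigraph model of
`ChiralClockComparisonMultigraph.lean` is the case `N = 3` (same weight, `omegaPow` = the exponential with the same angle).  Relevance: the centre of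
`SU(N)`, `N` odd, is `ℤ_N`; this is the comparison step of a
centre-blind ladder for every odd `N`, the layer translation being the `N`-analogue of `RobustBall/ZThreeLayerClock`.  PRIOR ART: MMP 1978 Prop. 1 /
Garban–Spencer 2022 App. Thm 21 (plane rotator); no novelty claimed for the inequality.  Nothing continuum / Clay.
-/

noncomputable section

open Finset Real

namespace Summit.Ventures.YMGap.Conjectures

variable {N : ℕ} [NeZero N] {V J : Type*} [Fintype V] [DecidableEq V] [Fintype J]

/-! ### The `ℤ_N` clock model with a finite family of complex pair couplings -/

/-- The weight `w(k) = exp(∑_j a_j cos(2π·val(k_{u_j} − k_{v_j})/N + φ_j))` on `V → ℤ/N`. [cite: MessagerMiracleSolePfister1978, Prop. 1] -/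
def clockWeightN (N : ℕ) [NeZero N] (u v : J → V) (a φ : J → ℝ) (k : V → ZMod N) : ℝ :=
  Real.exp (∑ j, a j * Real.cos (2 * π * (((k (u j) - k (v j)).val : ℕ) : ℝ) / N + φ j))

/-- The two-point function `⟨ψ_N(k_b − k_t)⟩ = (∑_k w(k) e^{2πi·val(k_b−k_t)/N}) / ∑_k w(k)`. [cite: MessagerMiracleSolePfister1978, Prop. 1] -/
def clockCorrN (N : ℕ) [NeZero N] (u v : J → V) (a φ : J → ℝ) (b t : V) : ℂ :=
  (∑ k : V → ZMod N, (clockWeightN N u v a φ k : ℂ) *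
      Complex.exp (((2 * π * (((k b - k t).val : ℕ) : ℝ) / N : ℝ) : ℂ) * Complex.I)) /
    ∑ k : V → ZMod N, (clockWeightN N u v a φ k : ℂ)

/-! ### `ℤ_N` bookkeeping -/

omit [NeZero N] in
/-- If the integer `z` represents `m ∈ ℤ_N` then `2π·val(m)/N` and `2πz/N` differ by an integer multiple of `2π`. [folklore] -/
theorem exists_angle_val_eq_N [NeZero N] (m : ZMod N) (z : ℤ) (h : (z : ZMod N) = m) :
    ∃ j : ℤ, 2 * π * ((m.val : ℕ) : ℝ) / N = 2 * π * (z : ℝ) / N + (j : ℝ) * (2 * π) := by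
  have hN : (N : ℝ) ≠ 0 := by exact_mod_cast (NeZero.ne N)
  have h1 : ((m.val : ℤ) : ZMod N) = (z : ZMod N) := by
    rw [h, Int.cast_natCast, ZMod.natCast_zmod_val]
  have h2 : (N : ℤ) ∣ z - (m.val : ℤ) := ((ZMod.intCast_eq_intCast_iff (m.val : ℤ) z N).1 h1).dvd
  obtain ⟨j, hj⟩ := h2
  refine ⟨-j, ?_⟩
  have hz : ((m.val : ℕ) : ℝ) = (z : ℝ) - (N : ℝ) * (j : ℝ) := by
    have : ((m.val : ℤ) : ℝ) = (z : ℝ) - (N : ℝ) * (j : ℝ) := by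
      have e : (m.val : ℤ) = z - N * j := by linarith
      rw [e]; push_cast; ring
    exact_mod_cast this
  rw [hz]
  field_simp
  push_cast
  ring

/-- `cos(2π·val(m)/N + c) = cos(2πz/N + c)` whenever `z` represents `m`. [folklore] -/
theorem cos_angle_val_N (m : ZMod N) (z : ℤ) (h : (z : ZMod N) = m) (c : ℝ) :
    Real.cos (2 * π * ((m.val : ℕ) : ℝ) / N + c) = Real.cos (2 * π * (z : ℝ) / N + c) := by
  obtain ⟨j, hj⟩ := exists_angle_val_eq_N m z h
  rw [hj, show 2 * π * (z : ℝ) / N + (j : ℝ) * (2 * π) + c = (2 * π * (z : ℝ) / N + c) + (j : ℝ) * (2 * π) by ring,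
    Real.cos_add_int_mul_two_pi]

/-- **The half-angle identities on `ℤ_N`** (no parity hypothesis): for `P, Q ∈ ℤ_N`, real `φ`, `α = 2π·val(P)/N + φ/2`, `β = 2π·val(Q)/N + φ/2`:
`cos(2π·val(P−Q)/N) + cos(2π·val(P+Q)/N + φ) = 2cos α cos β` and `cos(2π·val(P−Q)/N) − cos(2π·val(P+Q)/N + φ) = 2 sin α sin β`.
[cite: MessagerMiracleSolePfister1978, Prop. 1] -/
theorem cos_val_sub_add_cos_val_add_N (P Q : ZMod N) (φ : ℝ) :
    Real.cos (2 * π * (((P - Q).val : ℕ) : ℝ) / N) + Real.cos (2 * π * (((P + Q).val : ℕ) : ℝ) / N + φ) =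
        2 * (Real.cos (2 * π * ((P.val : ℕ) : ℝ) / N + φ / 2) * Real.cos (2 * π * ((Q.val : ℕ) : ℝ) / N + φ / 2)) ∧
      Real.cos (2 * π * (((P - Q).val : ℕ) : ℝ) / N) - Real.cos (2 * π * (((P + Q).val : ℕ) : ℝ) / N + φ) =
        2 * (Real.sin (2 * π * ((P.val : ℕ) : ℝ) / N + φ / 2) * Real.sin (2 * π * ((Q.val : ℕ) : ℝ) / N + φ / 2)) := by
  have hsub : (((P.val : ℤ) - (Q.val : ℤ) : ℤ) : ZMod N) = P - Q := by
    push_cast; rw [ZMod.natCast_zmod_val, ZMod.natCast_zmod_val]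
  have hadd : (((P.val : ℤ) + (Q.val : ℤ) : ℤ) : ZMod N) = P + Q := by
    push_cast; rw [ZMod.natCast_zmod_val, ZMod.natCast_zmod_val]
  have e1 : Real.cos (2 * π * (((P - Q).val : ℕ) : ℝ) / N) = Real.cos (2 * π * (((P.val : ℤ) - (Q.val : ℤ) : ℤ) : ℝ) / N + 0) := by
    rw [← cos_angle_val_N (P - Q) _ hsub 0, add_zero]
  have e2 : Real.cos (2 * π * (((P + Q).val : ℕ) : ℝ) / N + φ) = Real.cos (2 * π * (((P.val : ℤ) + (Q.val : ℤ) : ℤ) : ℝ) / N + φ) :=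
    cos_angle_val_N (P + Q) _ hadd φ
  have trig1 : ∀ α β : ℝ, Real.cos (α - β) + Real.cos (α + β) = 2 * (Real.cos α * Real.cos β) := by
    intro α β; rw [Real.cos_sub, Real.cos_add]; ring
  have trig2 : ∀ α β : ℝ, Real.cos (α - β) - Real.cos (α + β) = 2 * (Real.sin α * Real.sin β) := by
    intro α β; rw [Real.cos_sub, Real.cos_add]; ring
  have f1 : 2 * π * (((P.val : ℤ) - (Q.val : ℤ) : ℤ) : ℝ) / N + 0 =
      (2 * π * ((P.val : ℕ) : ℝ) / N + φ / 2) - (2 * π * ((Q.val : ℕ) : ℝ) / N + φ / 2) := by push_cast; ring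
  have f2 : 2 * π * (((P.val : ℤ) + (Q.val : ℤ) : ℤ) : ℝ) / N + φ =
      (2 * π * ((P.val : ℕ) : ℝ) / N + φ / 2) + (2 * π * ((Q.val : ℕ) : ℝ) / N + φ / 2) := by push_cast; ring
  rw [e1, e2, f1, f2]
  exact ⟨trig1 _ _, trig2 _ _⟩

omit [NeZero N] in
/-- In `ℤ_N` with `N` odd, `h = (N+1)/2` inverts `2`: `2h = 1`. [folklore] -/
theorem two_mul_half_eq_one (hN : Odd N) : (2 : ZMod N) * (((N + 1) / 2 : ℕ) : ZMod N) = 1 := by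
  obtain ⟨m, hm⟩ := hN
  have h1 : (N + 1) / 2 = m + 1 := by omega
  rw [h1]
  have h2 : ((2 * (m + 1) : ℕ) : ZMod N) = ((N + 1 : ℕ) : ZMod N) := by
    congr 1; omega
  have h3 : ((N + 1 : ℕ) : ZMod N) = 1 := by
    push_cast; rw [ZMod.natCast_self, zero_add]
  calc (2 : ZMod N) * ((m + 1 : ℕ) : ZMod N) = ((2 * (m + 1) : ℕ) : ZMod N) := by push_cast; ring
    _ = 1 := by rw [h2, h3]

omit [NeZero N] [Fintype V] [DecidableEq V] in
/-- Differences of edge spins for a general vertex type. [folklore] -/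
theorem sub_apply_sub_sub_apply_N (p q : V → ZMod N) (x y : V) :
    (p - q) x - (p - q) y = (p x - p y) - (q x - q y) ∧ (p + q) x - (p + q) y = (p x - p y) + (q x - q y) := by
  simp only [Pi.sub_apply, Pi.add_apply]
  constructor <;> ring

/-! ### The duplication identity for odd `N` -/

/-- **THE MMP DUPLICATION IDENTITY on `ℤ_N`, `N` odd.** [cite: MessagerMiracleSolePfister1978, Prop. 1] -/
theorem clockN_duplication (hN : Odd N) (u v : J → V) (a φ : J → ℝ) (b t : V) (ψ : ℝ) :
    ∑ k : V → ZMod N, ∑ k' : V → ZMod N,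
      (Real.cos (2 * π * (((k b - k t).val : ℕ) : ℝ) / N) - Real.cos (2 * π * (((k' b - k' t).val : ℕ) : ℝ) / N + -ψ)) *
        (clockWeightN N u v a (fun _ => 0) k * clockWeightN N u v a φ k') =
    2 * ∑ p : V → ZMod N, ∑ q : V → ZMod N,
      -Real.sin (2 * π * (((p b - p t).val : ℕ) : ℝ) / N + -ψ / 2) * -Real.sin (2 * π * (((q b - q t).val : ℕ) : ℝ) / N + -ψ / 2) *
        Real.exp (∑ j, 2 * a j *
          (Real.cos (2 * π * (((p (u j) - p (v j)).val : ℕ) : ℝ) / N + φ j / 2) *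
            Real.cos (2 * π * (((q (u j) - q (v j)).val : ℕ) : ℝ) / N + φ j / 2))) := by
  classical
  -- the substitution: `h` inverts `2`
  set h : ZMod N := (((N + 1) / 2 : ℕ) : ZMod N) with hh
  have h2 : (2 : ZMod N) * h = 1 := two_mul_half_eq_one hN
  have key1 : ∀ x y : ZMod N, h * (x - y + (x + y)) = x := fun x y => by
    linear_combination x * h2
  have key2 : ∀ x y : ZMod N, h * (x + y - (x - y)) = y := fun x y => by
    linear_combination y * h2
  have key3 : ∀ x y : ZMod N, h * (x + y) - h * (y - x) = x := fun x y => by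
    linear_combination x * h2
  have key4 : ∀ x y : ZMod N, h * (x + y) + h * (y - x) = y := fun x y => by
    linear_combination y * h2
  let e : (V → ZMod N) × (V → ZMod N) ≃ (V → ZMod N) × (V → ZMod N) :=
    { toFun := fun pq => (pq.1 - pq.2, pq.1 + pq.2)
      invFun := fun kk => (fun x => h * (kk.1 x + kk.2 x), fun x => h * (kk.2 x - kk.1 x))
      left_inv := fun pq => by
        refine Prod.ext (funext fun x => ?_) (funext fun x => ?_)
        · simp only [Pi.sub_apply, Pi.add_apply, key1]
        · simp only [Pi.sub_apply, Pi.add_apply, key2]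
      right_inv := fun kk => by
        refine Prod.ext (funext fun x => ?_) (funext fun x => ?_)
        · simp only [Pi.sub_apply, key3]
        · simp only [Pi.add_apply, key4] }
  -- termwise identity after the substitution
  have hterm : ∀ p q : V → ZMod N,
      (Real.cos (2 * π * ((((p - q) b - (p - q) t).val : ℕ) : ℝ) / N) -
          Real.cos (2 * π * ((((p + q) b - (p + q) t).val : ℕ) : ℝ) / N + -ψ)) *
        (clockWeightN N u v a (fun _ => 0) (p - q) * clockWeightN N u v a φ (p + q)) =
      2 * (-Real.sin (2 * π * (((p b - p t).val : ℕ) : ℝ) / N + -ψ / 2) * -Real.sin (2 * π * (((q b - q t).val : ℕ) : ℝ) / N + -ψ / 2) *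
        Real.exp (∑ j, 2 * a j *
          (Real.cos (2 * π * (((p (u j) - p (v j)).val : ℕ) : ℝ) / N + φ j / 2) *
            Real.cos (2 * π * (((q (u j) - q (v j)).val : ℕ) : ℝ) / N + φ j / 2)))) := by
    intro p q
    have hobs : Real.cos (2 * π * ((((p - q) b - (p - q) t).val : ℕ) : ℝ) / N) -
        Real.cos (2 * π * ((((p + q) b - (p + q) t).val : ℕ) : ℝ) / N + -ψ) =
        2 * (Real.sin (2 * π * (((p b - p t).val : ℕ) : ℝ) / N + -ψ / 2) *
          Real.sin (2 * π * (((q b - q t).val : ℕ) : ℝ) / N + -ψ / 2)) := by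
      rw [(sub_apply_sub_sub_apply_N p q b t).1, (sub_apply_sub_sub_apply_N p q b t).2]
      exact (cos_val_sub_add_cos_val_add_N (p b - p t) (q b - q t) (-ψ)).2
    have hw : clockWeightN N u v a (fun _ => 0) (p - q) * clockWeightN N u v a φ (p + q) =
        Real.exp (∑ j, 2 * a j *
          (Real.cos (2 * π * (((p (u j) - p (v j)).val : ℕ) : ℝ) / N + φ j / 2) *
            Real.cos (2 * π * (((q (u j) - q (v j)).val : ℕ) : ℝ) / N + φ j / 2))) := by
      unfold clockWeightN
      rw [← Real.exp_add, ← Finset.sum_add_distrib]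
      congr 1
      refine Finset.sum_congr rfl fun j _ => ?_
      have hj := (cos_val_sub_add_cos_val_add_N (p (u j) - p (v j)) (q (u j) - q (v j)) (φ j)).1
      rw [(sub_apply_sub_sub_apply_N p q (u j) (v j)).1, (sub_apply_sub_sub_apply_N p q (u j) (v j)).2]
      simp only [add_zero]
      linear_combination (a j) * hj
    rw [hobs, hw]
    ring
  let F : (V → ZMod N) → (V → ZMod N) → ℝ := fun k k' =>
    (Real.cos (2 * π * (((k b - k t).val : ℕ) : ℝ) / N) - Real.cos (2 * π * (((k' b - k' t).val : ℕ) : ℝ) / N + -ψ)) *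
      (clockWeightN N u v a (fun _ => 0) k * clockWeightN N u v a φ k')
  let R : (V → ZMod N) → (V → ZMod N) → ℝ := fun p q =>
    -Real.sin (2 * π * (((p b - p t).val : ℕ) : ℝ) / N + -ψ / 2) * -Real.sin (2 * π * (((q b - q t).val : ℕ) : ℝ) / N + -ψ / 2) *
      Real.exp (∑ j, 2 * a j *
        (Real.cos (2 * π * (((p (u j) - p (v j)).val : ℕ) : ℝ) / N + φ j / 2) *
          Real.cos (2 * π * (((q (u j) - q (v j)).val : ℕ) : ℝ) / N + φ j / 2)))
  show ∑ k, ∑ k', F k k' = 2 * ∑ p, ∑ q, R p q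
  have L : ∑ kk : (V → ZMod N) × (V → ZMod N), F kk.1 kk.2 =
      ∑ pq : (V → ZMod N) × (V → ZMod N), F (e pq).1 (e pq).2 := (e.sum_comp (fun kk => F kk.1 kk.2)).symm
  rw [← Fintype.sum_prod_type', ← Fintype.sum_prod_type', Finset.mul_sum, L]
  exact Finset.sum_congr rfl fun pq _ => hterm pq.1 pq.2

/-! ### The comparison theorem for odd `N` -/

/-- The partition function is positive. [folklore] -/
theorem sum_clockWeightN_pos (u v : J → V) (a φ : J → ℝ) : 0 < ∑ k : V → ZMod N, clockWeightN N u v a φ k :=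
  Finset.sum_pos (fun k _ => by unfold clockWeightN; exact Real.exp_pos _) Finset.univ_nonempty

/-- `Re(e^{−iψ} ⟨ψ_N(k_b−k_t)⟩_{a,φ}) = (∑_k w(k) cos(2π·val(k_b−k_t)/N − ψ)) / Z`. [folklore] -/
theorem re_exp_mul_clockCorrN (u v : J → V) (a φ : J → ℝ) (b t : V) (ψ : ℝ) :
    (Complex.exp (-(ψ : ℂ) * Complex.I) * clockCorrN N u v a φ b t).re =
      (∑ k : V → ZMod N, clockWeightN N u v a φ k * Real.cos (2 * π * (((k b - k t).val : ℕ) : ℝ) / N + -ψ)) /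
        ∑ k : V → ZMod N, clockWeightN N u v a φ k := by
  unfold clockCorrN
  rw [← Complex.ofReal_sum, ← mul_div_assoc, Complex.div_ofReal_re, Finset.mul_sum, Complex.re_sum]
  congr 1
  refine Finset.sum_congr rfl fun k _ => ?_
  have : Complex.exp (-(ψ : ℂ) * Complex.I) * ((clockWeightN N u v a φ k : ℂ) *
      Complex.exp (((2 * π * (((k b - k t).val : ℕ) : ℝ) / N : ℝ) : ℂ) * Complex.I)) =
      (clockWeightN N u v a φ k : ℂ) * Complex.exp (((2 * π * (((k b - k t).val : ℕ) : ℝ) / N + -ψ : ℝ) : ℂ) * Complex.I) := by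
    rw [mul_left_comm, ← Complex.exp_add]
    congr 2
    push_cast
    ring
  rw [this, Complex.re_ofReal_mul, Complex.exp_ofReal_mul_I_re]

/-- **ROTATED COMPARISON, `ℤ_N` with `N` odd**: for `a ≥ 0` and every real `ψ`, `Re(e^{−iψ} ⟨ψ_N(k_b−k_t)⟩_{a,φ}) ≤ Re ⟨ψ_N(k_b−k_t)⟩_{a,0}`.
[cite: MessagerMiracleSolePfister1978, Prop. 1] -/
theorem re_exp_mul_clockCorrN_le (hN : Odd N) (u v : J → V) (a φ : J → ℝ) (ha : ∀ j, 0 ≤ a j) (b t : V) (ψ : ℝ) :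
    (Complex.exp (-(ψ : ℂ) * Complex.I) * clockCorrN N u v a φ b t).re ≤ (clockCorrN N u v a (fun _ => 0) b t).re := by
  have h0 : (clockCorrN N u v a (fun _ => 0) b t).re =
      (Complex.exp (-((0 : ℝ) : ℂ) * Complex.I) * clockCorrN N u v a (fun _ => 0) b t).re := by
    simp
  rw [h0, re_exp_mul_clockCorrN, re_exp_mul_clockCorrN]
  have hZ0 := sum_clockWeightN_pos (N := N) u v a (fun _ => 0)
  have hZ1 := sum_clockWeightN_pos (N := N) u v a φ
  rw [div_le_div_iff₀ hZ1 hZ0]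
  have hD := clockN_duplication hN u v a φ b t ψ
  have hnonneg : 0 ≤ ∑ k : V → ZMod N, ∑ k' : V → ZMod N,
      (Real.cos (2 * π * (((k b - k t).val : ℕ) : ℝ) / N) - Real.cos (2 * π * (((k' b - k' t).val : ℕ) : ℝ) / N + -ψ)) *
        (clockWeightN N u v a (fun _ => 0) k * clockWeightN N u v a φ k') := by
    rw [hD]
    refine mul_nonneg (by norm_num) ?_
    have := sum_mul_mul_exp_sum_nonneg (X := V → ZMod N) (J := J)
      (fun p => -Real.sin (2 * π * (((p b - p t).val : ℕ) : ℝ) / N + -ψ / 2)) (fun j => 2 * a j)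
      (fun j => by have := ha j; positivity)
      (fun j p => Real.cos (2 * π * (((p (u j) - p (v j)).val : ℕ) : ℝ) / N + φ j / 2))
    simpa using this
  have hsplit : ∑ k : V → ZMod N, ∑ k' : V → ZMod N,
      (Real.cos (2 * π * (((k b - k t).val : ℕ) : ℝ) / N) - Real.cos (2 * π * (((k' b - k' t).val : ℕ) : ℝ) / N + -ψ)) *
        (clockWeightN N u v a (fun _ => 0) k * clockWeightN N u v a φ k') =
      (∑ k : V → ZMod N, clockWeightN N u v a (fun _ => 0) k * Real.cos (2 * π * (((k b - k t).val : ℕ) : ℝ) / N + -(0 : ℝ))) *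
          (∑ k : V → ZMod N, clockWeightN N u v a φ k) -
        (∑ k : V → ZMod N, clockWeightN N u v a φ k * Real.cos (2 * π * (((k b - k t).val : ℕ) : ℝ) / N + -ψ)) *
          (∑ k : V → ZMod N, clockWeightN N u v a (fun _ => 0) k) := by
    have e1 : ∀ k k' : V → ZMod N,
        (Real.cos (2 * π * (((k b - k t).val : ℕ) : ℝ) / N) - Real.cos (2 * π * (((k' b - k' t).val : ℕ) : ℝ) / N + -ψ)) *
          (clockWeightN N u v a (fun _ => 0) k * clockWeightN N u v a φ k') =
        clockWeightN N u v a (fun _ => 0) k * Real.cos (2 * π * (((k b - k t).val : ℕ) : ℝ) / N + -(0 : ℝ)) *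
            clockWeightN N u v a φ k' -
          clockWeightN N u v a φ k' * Real.cos (2 * π * (((k' b - k' t).val : ℕ) : ℝ) / N + -ψ) *
            clockWeightN N u v a (fun _ => 0) k := by
      intro k k'; rw [neg_zero, add_zero]; ring
    simp_rw [e1, Finset.sum_sub_distrib]
    rw [← Finset.sum_mul_sum, Finset.sum_comm, ← Finset.sum_mul_sum]
  rw [hsplit] at hnonneg
  linarith

/-- **GRIFFITHS' FIRST INEQUALITY, `ℤ_N` with `N` odd**: `0 ≤ Re ⟨ψ_N(k_b−k_t)⟩_{a,0}` for `a ≥ 0`. [folklore] -/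
theorem clockCorrN_zero_re_nonneg (hN : Odd N) (u v : J → V) (a : J → ℝ) (ha : ∀ j, 0 ≤ a j) (b t : V) :
    0 ≤ (clockCorrN N u v a (fun _ => 0) b t).re := by
  have h1 := re_exp_mul_clockCorrN_le hN u v a (fun _ => 0) ha b t 0
  have h2 := re_exp_mul_clockCorrN_le hN u v a (fun _ => 0) ha b t π
  have e : Complex.exp (-(π : ℂ) * Complex.I) = -1 := by
    rw [show -(π : ℂ) * Complex.I = -(π * Complex.I) by ring, Complex.exp_neg, Complex.exp_pi_mul_I]; norm_num
  rw [e] at h2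
  simp only [neg_mul, one_mul, Complex.neg_re] at h2
  linarith

/-- **THE CHIRAL CLOCK COMPARISON FOR `ℤ_N`, `N` ODD** (every finite vertex type, every finite family of pair terms with `a ≥ 0`, all phases, all
`b, t`): `‖⟨ψ_N(k_b−k_t)⟩_{a,φ}‖ ≤ Re ⟨ψ_N(k_b−k_t)⟩_{a,0}`. [cite: MessagerMiracleSolePfister1978, Prop. 1] -/
theorem clockComparisonN (hN : Odd N) (u v : J → V) (a φ : J → ℝ) (ha : ∀ j, 0 ≤ a j) (b t : V) :
    ‖clockCorrN N u v a φ b t‖ ≤ (clockCorrN N u v a (fun _ => 0) b t).re := by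
  set c := clockCorrN N u v a φ b t with hc
  have hrot : (Complex.exp (-(Complex.arg c : ℂ) * Complex.I) * c).re = ‖c‖ := by
    have h := Complex.norm_mul_exp_arg_mul_I c
    have : Complex.exp (-(Complex.arg c : ℂ) * Complex.I) * c = (‖c‖ : ℂ) := by
      calc Complex.exp (-(Complex.arg c : ℂ) * Complex.I) * c
          = Complex.exp (-(Complex.arg c : ℂ) * Complex.I) * ((‖c‖ : ℂ) * Complex.exp ((Complex.arg c : ℂ) * Complex.I)) := by
            rw [h]
        _ = (‖c‖ : ℂ) * Complex.exp (-(Complex.arg c : ℂ) * Complex.I + (Complex.arg c : ℂ) * Complex.I) := by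
            rw [Complex.exp_add]; ring
        _ = (‖c‖ : ℂ) := by rw [show -(Complex.arg c : ℂ) * Complex.I + (Complex.arg c : ℂ) * Complex.I = 0 by ring,
            Complex.exp_zero, mul_one]
    rw [this, Complex.ofReal_re]
  rw [← hrot]
  exact re_exp_mul_clockCorrN_le hN u v a φ ha b t (Complex.arg c)

end Summit.Ventures.YMGap.Conjectures

end
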